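/-
Copyright: internal research formalization. Source texts: G. Kempf, F. Knudsen, D. Mumford,
B. Saint-Donat, Toroidal Embeddings I (LNM 339, Springer 1973) [KempfEtAl1973], Ch. I §2, Theorems
10–11 and the proof of Theorem 11; W. Fulton, Introduction to Toric Varieties [Fulton1993Toric], §1.2.
-/
import Mathlib
import HarnessLib
import Literature.Geometry.PolyhedralFans.ProjectiveSubdivision

/-!
# Support functions on fans, III: tight pieces (`Fan.IsStrictSupport`)

Topic: `Literature/Geometry/PolyhedralFans`. The consumer interface requested by the Kato (10.4)
programme: cone-indexed linear pieces `m ρ` of a strictly concave `Δ`-linear function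
`h = min_ρ ⟨m ρ, ·⟩` whose minimum locus on every cone `ρ'` is tight — `⟨m ρ, u⟩ = h(u)` for
`u ∈ ρ'` only when `u ∈ ρ` — quantified over ALL cones (faces included). We obtain it from
`Fan.SupportData` (Parts I–II) by **tightening**: `m ρ := M a_ρ + ℓ_ρ` with `ℓ_ρ` the functional
exposing the face `ρ` inside the linearity domain of `a_ρ` and `M` large ([KempfEtAl1973] I §2,
proof of Thm. 11: the associated polyhedra of the final function are exactly the simplices).

## Content (all PROVED; no named facts)

* `Fan.IsStrictSupport Δ m` — the Prop (verbatim from the programme's interface);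
  `IsStrictSupport.smul`, `IsStrictSupport.add` — stability under positive scaling and adding one
  linear functional;
* `Fan.SupportData.isStrictSupport_tightPiece` — tightening;
* `Fan.exists_nat_smul_integral`, `Fan.exists_add_nonneg_on` — integrality / positivity
  normalisations for cone-indexed functionals;
* `Fan.exists_isStrictSupport_starIter` — for `σ ⊆ ℚ^κ` finitely generated and salient and ANY
  list `l`, the iterated star subdivision `(Fan.ofCone σ).starIter l` carries an integral tight
  strict support `m` with all `m ρ ≥ 0` on `σ`;
* `Fan.exists_regular_refinement_isStrictSupport` — combined with `Fan.exists_regular_refinement`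
  ([KempfEtAl1973] I §2 Thm. 11, one cone).
-/

noncomputable section

namespace Literature.Geometry.PolyhedralFans

open PointedCone Finset Matrix

variable {𝕜 : Type*} [Field 𝕜] [LinearOrder 𝕜] [IsStrictOrderedRing 𝕜]
variable {κ : Type*} [Fintype κ]

/-! ## The interface -/

/-- **Tight strictly concave support data** on a fan: cone-indexed linear pieces `m ρ` such that on
every cone `ρ'` its own piece is the smallest, and agrees with the piece of `ρ` at `u ∈ ρ'` only if
`u ∈ ρ` (the minimum locus of `m ρ` is exactly `ρ`; all cones, not only the maximal ones: "the
associated polyhedra" of `h = min_ρ ⟨m ρ, ·⟩` are the cones, [KempfEtAl1973] I §2 Thm. 10 and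
proof of Thm. 11 (2)). [cite: KempfEtAl1973, I §2 Thm. 10] -/
def Fan.IsStrictSupport (Δ : Fan 𝕜 (κ → 𝕜)) (m : PointedCone 𝕜 (κ → 𝕜) → (κ → 𝕜)) : Prop :=
  ∀ ⦃ρ⦄, ρ ∈ Δ.cones → ∀ ⦃ρ'⦄, ρ' ∈ Δ.cones → ∀ ⦃u⦄, u ∈ ρ' →
    m ρ' ⬝ᵥ u ≤ m ρ ⬝ᵥ u ∧ (m ρ' ⬝ᵥ u = m ρ ⬝ᵥ u → u ∈ ρ)

namespace Fan.IsStrictSupport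

variable {Δ : Fan 𝕜 (κ → 𝕜)} {m : PointedCone 𝕜 (κ → 𝕜) → (κ → 𝕜)}

/-- Positive scaling preserves tight strict support data. [cite: KempfEtAl1973, I §2 Thm. 11 proof (2)] -/
theorem smul (h : Δ.IsStrictSupport m) {c : 𝕜} (hc : 0 < c) :
    Δ.IsStrictSupport fun ρ => c • m ρ := by
  intro ρ hρ ρ' hρ' u hu
  obtain ⟨hle, heq⟩ := h hρ hρ' hu
  simp only [smul_dotProduct, smul_eq_mul]
  exact ⟨mul_le_mul_of_nonneg_left hle hc.le, fun e => heq (mul_left_cancel₀ hc.ne' e)⟩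

/-- Adding one linear functional to all pieces preserves tight strict support data.
[cite: KempfEtAl1973, I §2 Thm. 10] -/
theorem add (h : Δ.IsStrictSupport m) (w : κ → 𝕜) : Δ.IsStrictSupport fun ρ => m ρ + w := by
  intro ρ hρ ρ' hρ' u hu
  obtain ⟨hle, heq⟩ := h hρ hρ' hu
  simp only [add_dotProduct]
  exact ⟨add_le_add hle le_rfl, fun e => heq (add_right_cancel e)⟩

/-- The pieces of tight data are pairwise comparable minima: `h(u) := ⟨m ρ', u⟩` for `u ∈ ρ'` does
not depend on the cone `ρ' ∋ u`. [cite: KempfEtAl1973, I §2 Thm. 10] -/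
theorem eq_of_mem_of_mem (h : Δ.IsStrictSupport m) {ρ ρ' : PointedCone 𝕜 (κ → 𝕜)}
    (hρ : ρ ∈ Δ.cones) (hρ' : ρ' ∈ Δ.cones) {u : κ → 𝕜} (hu : u ∈ ρ) (hu' : u ∈ ρ') :
    m ρ ⬝ᵥ u = m ρ' ⬝ᵥ u :=
  le_antisymm (h hρ' hρ hu).1 (h hρ hρ' hu').1

end Fan.IsStrictSupport

/-! ## Tightening `Fan.SupportData` -/

namespace Fan.SupportData

variable {Δ : Fan 𝕜 (κ → 𝕜)} (D : Δ.SupportData)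

open Classical in
/-- The functional exposing the face `ρ` inside the linearity domain of its piece (`≥ 0` on the
domain, `= 0` exactly on `ρ`); `0` off the fan. [cite: Fulton1993Toric, §1.2 (2)] -/
def tightExpose (ρ : PointedCone 𝕜 (κ → 𝕜)) : κ → 𝕜 :=
  if hρ : ρ ∈ Δ.cones then
    (exists_dotProduct_exposing (Δ.isFaceOf_of_le (D.domain_mem hρ) hρ (D.le_domain hρ))
      (Δ.fg (D.domain_mem hρ))).choose
  else 0

/-- `ℓ_ρ ≥ 0` on the domain. [cite: Fulton1993Toric, §1.2 (2)] -/
theorem tightExpose_nonneg {ρ : PointedCone 𝕜 (κ → 𝕜)} (hρ : ρ ∈ Δ.cones) {x : κ → 𝕜}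
    (hx : x ∈ D.domain ρ) : 0 ≤ D.tightExpose ρ ⬝ᵥ x := by
  rw [tightExpose, dif_pos hρ]
  exact (exists_dotProduct_exposing (Δ.isFaceOf_of_le (D.domain_mem hρ) hρ (D.le_domain hρ))
    (Δ.fg (D.domain_mem hρ))).choose_spec.1 x hx

/-- `ℓ_ρ = 0` exactly on `ρ` (inside the domain). [cite: Fulton1993Toric, §1.2 (2)] -/
theorem tightExpose_eq_zero_iff {ρ : PointedCone 𝕜 (κ → 𝕜)} (hρ : ρ ∈ Δ.cones) {x : κ → 𝕜}
    (hx : x ∈ D.domain ρ) : D.tightExpose ρ ⬝ᵥ x = 0 ↔ x ∈ ρ := by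
  rw [tightExpose, dif_pos hρ]
  exact (exists_dotProduct_exposing (Δ.isFaceOf_of_le (D.domain_mem hρ) hρ (D.le_domain hρ))
    (Δ.fg (D.domain_mem hρ))).choose_spec.2 x hx

variable (Δ) in
/-- All generators of all cones of `Δ`. [cite: KempfEtAl1973, I §2 Thm. 11 proof (2)] -/
def tightGens : Finset (κ → 𝕜) := Δ.finite.toFinset.biUnion gens

open Classical in
/-- The ratio controlling the tightening constant at a generator off the domain.
[cite: KempfEtAl1973, I §2 Thm. 11 proof (2)] -/
def tightRatio (ρ : PointedCone 𝕜 (κ → 𝕜)) (g : κ → 𝕜) : 𝕜 :=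
  (-(D.tightExpose ρ ⬝ᵥ g)) / (D.piece ρ ⬝ᵥ g - D.f g)

/-- The tightening constant `M = 1 + Σ |ratios|`. [cite: KempfEtAl1973, I §2 Thm. 11 proof (2)] -/
def tightM : 𝕜 := 1 + ∑ ρ ∈ Δ.finite.toFinset, ∑ g ∈ tightGens Δ, |D.tightRatio ρ g|

/-- `|ratio| < M`. [cite: KempfEtAl1973, I §2 Thm. 11 proof (2)] -/
theorem abs_tightRatio_lt {ρ : PointedCone 𝕜 (κ → 𝕜)} (hρ : ρ ∈ Δ.cones) {g : κ → 𝕜}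
    (hg : g ∈ tightGens Δ) : |D.tightRatio ρ g| < D.tightM := by
  rw [tightM]
  have h1 : |D.tightRatio ρ g| ≤ ∑ g' ∈ tightGens Δ, |D.tightRatio ρ g'| :=
    Finset.single_le_sum (f := fun g' => |D.tightRatio ρ g'|) (fun _ _ => abs_nonneg _) hg
  have h2 : ∑ g' ∈ tightGens Δ, |D.tightRatio ρ g'| ≤
      ∑ ρ' ∈ Δ.finite.toFinset, ∑ g' ∈ tightGens Δ, |D.tightRatio ρ' g'| :=
    Finset.single_le_sum (f := fun ρ' => ∑ g' ∈ tightGens Δ, |D.tightRatio ρ' g'|)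
      (fun _ _ => Finset.sum_nonneg fun _ _ => abs_nonneg _) (Δ.finite.mem_toFinset.mpr hρ)
  linarith

/-- `0 < M`. [cite: KempfEtAl1973, I §2 Thm. 11 proof (2)] -/
theorem tightM_pos : 0 < D.tightM := by
  rw [tightM]
  have : 0 ≤ ∑ ρ ∈ Δ.finite.toFinset, ∑ g ∈ tightGens Δ, |D.tightRatio ρ g| :=
    Finset.sum_nonneg fun _ _ => Finset.sum_nonneg fun _ _ => abs_nonneg _
  linarith

/-- **The tight pieces** `m ρ := M a_ρ + ℓ_ρ`. [cite: KempfEtAl1973, I §2 Thm. 11 proof (2)] -/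
def tightPiece (ρ : PointedCone 𝕜 (κ → 𝕜)) : κ → 𝕜 := D.tightM • D.piece ρ + D.tightExpose ρ

/-- Inside the linearity domain of `a_ρ`: `M f ≤ m ρ`, with equality exactly on `ρ`.
[cite: KempfEtAl1973, I §2 Thm. 11 proof (2)] -/
theorem tight_local {ρ : PointedCone 𝕜 (κ → 𝕜)} (hρ : ρ ∈ Δ.cones) {x : κ → 𝕜}
    (hx : x ∈ D.domain ρ) :
    D.tightM * D.f x ≤ D.tightPiece ρ ⬝ᵥ x ∧ (D.tightM * D.f x = D.tightPiece ρ ⬝ᵥ x ↔ x ∈ ρ) := by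
  have hfx : D.f x = D.piece ρ ⬝ᵥ x := ((D.mem_domain_iff hρ).mp hx).2
  rw [tightPiece, add_dotProduct, smul_dotProduct, smul_eq_mul, ← hfx]
  have h0 := D.tightExpose_nonneg hρ hx
  refine ⟨by linarith, ?_⟩
  rw [← D.tightExpose_eq_zero_iff hρ hx]
  constructor
  · intro h; linarith
  · intro h; rw [h, add_zero]

/-- At a generator off the domain: `M f < m ρ` strictly. [cite: KempfEtAl1973, I §2 Thm. 11 proof (2)] -/
theorem tight_lt_at_gen {ρ : PointedCone 𝕜 (κ → 𝕜)} (hρ : ρ ∈ Δ.cones) {g : κ → 𝕜}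
    (hg : g ∈ tightGens Δ) (hgs : g ∈ Δ.support) (hgD : g ∉ D.domain ρ) :
    D.tightM * D.f g < D.tightPiece ρ ⬝ᵥ g := by
  set d := D.piece ρ ⬝ᵥ g - D.f g with hd
  have hdpos : 0 < d := by
    have := D.lt_piece_of_not_mem_domain hρ hgs hgD
    rw [hd]; linarith
  have hr : -(D.tightExpose ρ ⬝ᵥ g) = D.tightRatio ρ g * d := by
    rw [tightRatio, ← hd, div_mul_cancel₀ _ hdpos.ne']
  have h1 : D.tightRatio ρ g * d ≤ |D.tightRatio ρ g| * d :=
    mul_le_mul_of_nonneg_right (le_abs_self _) hdpos.le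
  have h2 : |D.tightRatio ρ g| * d < D.tightM * d :=
    mul_lt_mul_of_pos_right (D.abs_tightRatio_lt hρ hg) hdpos
  rw [tightPiece, add_dotProduct, smul_dotProduct, smul_eq_mul]
  have : -(D.tightExpose ρ ⬝ᵥ g) < D.tightM * d := by rw [hr]; linarith
  rw [hd] at this
  linarith

/-- At any generator: `M f ≤ m ρ`. [cite: KempfEtAl1973, I §2 Thm. 11 proof (2)] -/
theorem tight_le_at_gen {ρ : PointedCone 𝕜 (κ → 𝕜)} (hρ : ρ ∈ Δ.cones) {g : κ → 𝕜}
    (hg : g ∈ tightGens Δ) (hgs : g ∈ Δ.support) : D.tightM * D.f g ≤ D.tightPiece ρ ⬝ᵥ g := by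
  by_cases hgD : g ∈ D.domain ρ
  · exact (D.tight_local hρ hgD).1
  · exact (D.tight_lt_at_gen hρ hg hgs hgD).le

/-- **Global comparison for the tight pieces**: on the support `M f ≤ m ρ`, with equality only on
`ρ`. [cite: KempfEtAl1973, I §2 Thm. 11 proof (2)] -/
theorem tight_global {ρ : PointedCone 𝕜 (κ → 𝕜)} (hρ : ρ ∈ Δ.cones) {x : κ → 𝕜}
    (hx : x ∈ Δ.support) :
    D.tightM * D.f x ≤ D.tightPiece ρ ⬝ᵥ x ∧ (D.tightM * D.f x = D.tightPiece ρ ⬝ᵥ x → x ∈ ρ) := by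
  classical
  set M := D.tightM with hM
  obtain ⟨ρ', hρ', hxρ'⟩ := Fan.mem_support.mp hx
  have hfg' : ρ'.FG := Δ.fg hρ'
  have hxh : x ∈ PointedCone.hull 𝕜 ((gens ρ' : Finset (κ → 𝕜)) : Set (κ → 𝕜)) := by
    rw [hull_gens hfg']; exact hxρ'
  obtain ⟨c, hc, hcx⟩ := mem_hull_finset_iff.mp hxh
  have hgW : ∀ g ∈ gens ρ', g ∈ tightGens Δ := fun g hg =>
    Finset.mem_biUnion.mpr ⟨ρ', Δ.finite.mem_toFinset.mpr hρ', hg⟩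
  have hgs : ∀ g ∈ gens ρ', g ∈ Δ.support := fun g hg =>
    Fan.mem_support.mpr ⟨ρ', hρ', gens_subset hfg' hg⟩
  -- `M f` is linear on `ρ'`, given by `M a_{ρ'}`
  have hlin : ∀ y ∈ ρ', M * D.f y = (M • D.piece ρ') ⬝ᵥ y := fun y hy => by
    rw [smul_dotProduct, smul_eq_mul, D.eq_piece hρ' hy]
  set δ : (κ → 𝕜) → 𝕜 := fun g => D.tightPiece ρ ⬝ᵥ g - M * D.f g with hδ
  have hdiff : D.tightPiece ρ ⬝ᵥ x - M * D.f x = ∑ g ∈ gens ρ', c g * δ g := by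
    rw [hlin x hxρ', ← sub_dotProduct, ← hcx, dotProduct_sum]
    refine Finset.sum_congr rfl fun g hg => ?_
    rw [dotProduct_smul, smul_eq_mul, sub_dotProduct]
    simp only [hδ, hlin g (gens_subset hfg' hg)]
  have hδnn : ∀ g ∈ gens ρ', 0 ≤ δ g := fun g hg => by
    have := D.tight_le_at_gen hρ (hgW g hg) (hgs g hg)
    rw [hδ]; linarith
  have hsum_nn : 0 ≤ ∑ g ∈ gens ρ', c g * δ g :=
    Finset.sum_nonneg fun g hg => mul_nonneg (hc g hg) (hδnn g hg)
  refine ⟨by linarith, fun heq => ?_⟩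
  have hxD : x ∈ D.domain ρ := by
    by_contra hxD
    have hex : ∃ g ∈ gens ρ', c g ≠ 0 ∧ g ∉ D.domain ρ := by
      by_contra hall
      push Not at hall
      apply hxD
      rw [← hcx]
      refine Submodule.sum_mem _ fun g hg => ?_
      by_cases hcg : c g = 0
      · rw [hcg, zero_smul]; exact Submodule.zero_mem _
      · exact smul_mem_of_nonneg (hall g hg hcg) (hc g hg)
    obtain ⟨g, hg, hcg, hgD⟩ := hex
    have hpos : 0 < c g * δ g := by
      refine mul_pos (lt_of_le_of_ne (hc g hg) (Ne.symm hcg)) ?_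
      have := D.tight_lt_at_gen hρ (hgW g hg) (hgs g hg) hgD
      rw [hδ]; linarith
    have hsum_pos : 0 < ∑ g ∈ gens ρ', c g * δ g :=
      Finset.sum_pos' (fun g hg => mul_nonneg (hc g hg) (hδnn g hg)) ⟨g, hg, hpos⟩
    linarith
  exact ((D.tight_local hρ hxD).2).mp heq

/-- **Tightening**: the pieces `m ρ = M a_ρ + ℓ_ρ` of a strictly convex support function form
tight strict support data. [cite: KempfEtAl1973, I §2 Thm. 11 proof (2)] -/
theorem isStrictSupport_tightPiece : Δ.IsStrictSupport D.tightPiece := by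
  intro ρ hρ ρ' hρ' u hu
  have hus : u ∈ Δ.support := Fan.mem_support.mpr ⟨ρ', hρ', hu⟩
  have he : D.tightM * D.f u = D.tightPiece ρ' ⬝ᵥ u :=
    ((D.tight_local hρ' (D.le_domain hρ' hu)).2).mpr hu
  obtain ⟨hle, heq⟩ := D.tight_global hρ hus
  rw [he] at hle heq
  exact ⟨hle, heq⟩

end Fan.SupportData

/-! ## Normalisations for cone-indexed functionals -/

namespace Fan

/-- **Positivity**: finitely many functionals (indexed by the cones of a fan) can be made
simultaneously non-negative on a finitely generated salient cone `σ` by adding one functional (a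
large multiple of one strictly positive on `σ ∖ 0`). [cite: Fulton1993Toric, §1.2 (2)] -/
theorem exists_add_nonneg_on (Δ : Fan 𝕜 (κ → 𝕜)) (m : PointedCone 𝕜 (κ → 𝕜) → (κ → 𝕜))
    {σ : PointedCone 𝕜 (κ → 𝕜)} (hfg : σ.FG) (hsal : IsSalient σ) :
    ∃ w : κ → 𝕜, ∀ ρ ∈ Δ.cones, ∀ x ∈ σ, 0 ≤ (m ρ + w) ⬝ᵥ x := by
  classical
  obtain ⟨c₀, hc₀, hc₀0⟩ := exists_dotProduct_exposing (IsSalient.bot_isFaceOf hsal) hfg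
  have hpos : ∀ x ∈ σ, x ≠ 0 → 0 < c₀ ⬝ᵥ x := fun x hx hx0 =>
    lt_of_le_of_ne (hc₀ x hx) fun h => hx0 ((Submodule.mem_bot _).mp ((hc₀0 x hx).mp h.symm))
  obtain ⟨G, hG⟩ := hfg
  have hGσ : ∀ g ∈ G, g ∈ σ := fun g hg => hG ▸ Submodule.subset_span hg
  set N : 𝕜 := ∑ ρ ∈ Δ.finite.toFinset, ∑ g ∈ G,
    if g = 0 then 0 else |m ρ ⬝ᵥ g| / (c₀ ⬝ᵥ g) with hN
  have hterm_nn : ∀ ρ, ∀ g ∈ G, 0 ≤ (if g = 0 then 0 else |m ρ ⬝ᵥ g| / (c₀ ⬝ᵥ g)) := by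
    intro ρ g hg
    split_ifs with h
    · exact le_rfl
    · exact div_nonneg (abs_nonneg _) (hpos g (hGσ g hg) h).le
  have hNg : ∀ ρ ∈ Δ.cones, ∀ g ∈ G, g ≠ 0 → |m ρ ⬝ᵥ g| / (c₀ ⬝ᵥ g) ≤ N := by
    intro ρ hρ g hg hg0
    have h1 : |m ρ ⬝ᵥ g| / (c₀ ⬝ᵥ g) ≤
        ∑ g' ∈ G, if g' = 0 then 0 else |m ρ ⬝ᵥ g'| / (c₀ ⬝ᵥ g') :=
      (Finset.single_le_sum (f := fun g' => if g' = 0 then 0 else |m ρ ⬝ᵥ g'| / (c₀ ⬝ᵥ g'))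
        (fun g' hg' => hterm_nn ρ g' hg') hg).trans_eq' (by simp [hg0])
    have h2 : (∑ g' ∈ G, if g' = 0 then 0 else |m ρ ⬝ᵥ g'| / (c₀ ⬝ᵥ g')) ≤ N :=
      Finset.single_le_sum
        (f := fun ρ' => ∑ g' ∈ G, if g' = 0 then 0 else |m ρ' ⬝ᵥ g'| / (c₀ ⬝ᵥ g'))
        (fun ρ' _ => Finset.sum_nonneg fun g' hg' => hterm_nn ρ' g' hg')
        (Δ.finite.mem_toFinset.mpr hρ)
    exact h1.trans h2
  refine ⟨N • c₀, fun ρ hρ x hx => ?_⟩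
  have hgen : ∀ g ∈ G, 0 ≤ (m ρ + N • c₀) ⬝ᵥ g := by
    intro g hg
    rw [add_dotProduct, smul_dotProduct, smul_eq_mul]
    by_cases hg0 : g = 0
    · subst hg0; simp
    · have h2 : |m ρ ⬝ᵥ g| ≤ N * (c₀ ⬝ᵥ g) := by
        have := hNg ρ hρ g hg hg0
        rwa [div_le_iff₀ (hpos g (hGσ g hg) hg0)] at this
      have h3 : -(m ρ ⬝ᵥ g) ≤ |m ρ ⬝ᵥ g| := neg_le_abs _
      linarith
  have hxh : x ∈ PointedCone.hull 𝕜 (G : Set (κ → 𝕜)) := by rw [PointedCone.hull, hG]; exact hx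
  obtain ⟨a, ha, rfl⟩ := mem_hull_finset_iff.mp hxh
  rw [dotProduct_sum]
  exact Finset.sum_nonneg fun g hg => by
    rw [dotProduct_smul, smul_eq_mul]; exact mul_nonneg (ha g hg) (hgen g hg)

end Fan

/-! ## Over `ℚ`: integrality and the final statements -/

section Rational

variable {κ : Type*} [Fintype κ]

/-- **Integrality**: finitely many rational functionals (indexed by the cones of a fan) have a common
positive integer multiple in the lattice. [cite: Fulton1993Toric, §1.1 p. 4] -/
theorem Fan.exists_nat_smul_integral (Δ : Fan ℚ (κ → ℚ)) (m : PointedCone ℚ (κ → ℚ) → (κ → ℚ)) :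
    ∃ N : ℕ, 0 < N ∧ ∀ ρ ∈ Δ.cones, ((N : ℚ) • m ρ) ∈ latticeN κ := by
  classical
  choose N hN hNm using fun ρ : PointedCone ℚ (κ → ℚ) => exists_nat_smul_mem_latticeN (m ρ)
  refine ⟨∏ ρ ∈ Δ.finite.toFinset, N ρ, Finset.prod_pos fun ρ _ => hN ρ, fun ρ hρ => ?_⟩
  obtain ⟨k, hk⟩ : N ρ ∣ ∏ ρ' ∈ Δ.finite.toFinset, N ρ' :=
    Finset.dvd_prod_of_mem _ (Δ.finite.mem_toFinset.mpr hρ)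
  rw [hk, Nat.cast_mul, mul_comm, mul_smul]
  exact intCast_smul_mem_latticeN' k (hNm ρ)
where
  /-- integer multiples of lattice vectors are lattice vectors (natural-number form) -/
  intCast_smul_mem_latticeN' (k : ℕ) {x : κ → ℚ} (hx : x ∈ latticeN κ) :
      ((k : ℚ) • x) ∈ latticeN κ := by
    rw [mem_latticeN_iff] at hx ⊢
    intro i
    obtain ⟨z, hz⟩ := hx i
    exact ⟨k * z, by rw [Pi.smul_apply, smul_eq_mul, hz]; push_cast; ring⟩

/-- **Tight integral strict support data on any iterated star subdivision of a face fan** (the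
function "`f` … such that the associated polyhedra" are exactly the cones, [KempfEtAl1973] I §2,
proof of Thm. 11): for `σ ⊆ ℚ^κ` finitely generated and salient and any list `l` of vectors, the
fan `(Fan.ofCone σ).starIter l` carries `m` with `Fan.IsStrictSupport`, all `m ρ` in the lattice
and non-negative on `σ` (so in the dual monoid `σ^∨ ∩ M`). [cite: KempfEtAl1973, I §2 Thm. 11] -/
theorem Fan.exists_isStrictSupport_starIter [DecidableEq κ] (σ : PointedCone ℚ (κ → ℚ))
    (hfg : σ.FG) (hsal : IsSalient σ) (l : List (κ → ℚ)) :
    ∃ m : PointedCone ℚ (κ → ℚ) → (κ → ℚ),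
      ((Fan.ofCone σ hfg hsal).starIter l).IsStrictSupport m ∧
      (∀ ρ ∈ ((Fan.ofCone σ hfg hsal).starIter l).cones, m ρ ∈ latticeN κ) ∧
      (∀ ρ ∈ ((Fan.ofCone σ hfg hsal).starIter l).cones, ∀ x ∈ σ, 0 ≤ m ρ ⬝ᵥ x) := by
  set Δ' := (Fan.ofCone σ hfg hsal).starIter l with hΔ'
  obtain ⟨D⟩ := Fan.SupportData.nonempty_starIter l ⟨Fan.SupportData.ofCone σ hfg hsal⟩
  -- tighten, make non-negative on `σ`, clear denominators
  have h₁ : Δ'.IsStrictSupport D.tightPiece := D.isStrictSupport_tightPiece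
  obtain ⟨w, hw⟩ := Fan.exists_add_nonneg_on Δ' D.tightPiece hfg hsal
  have h₂ := h₁.add w
  obtain ⟨N, hN, hint⟩ := Fan.exists_nat_smul_integral Δ' fun ρ => D.tightPiece ρ + w
  have hN' : (0 : ℚ) < N := by exact_mod_cast hN
  refine ⟨fun ρ => (N : ℚ) • (D.tightPiece ρ + w), h₂.smul hN', hint, fun ρ hρ x hx => ?_⟩
  rw [smul_dotProduct, smul_eq_mul]
  exact mul_nonneg hN'.le (hw ρ hρ x hx)

/-- **[KempfEtAl1973] I §2 Theorem 11 (one cone), tight form**: a finitely generated salient cone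
`σ ⊆ ℚ^κ` has a regular simplicial refinement by star subdivisions of its face fan through nonzero
lattice vectors which carries tight integral strict support data, non-negative on `σ`.
[cite: KempfEtAl1973, I §2 Thm. 11] -/
theorem Fan.exists_regular_refinement_isStrictSupport [DecidableEq κ] (σ : PointedCone ℚ (κ → ℚ))
    (hfg : σ.FG) (hsal : IsSalient σ) :
    ∃ l : List (κ → ℚ), (∀ w ∈ l, w ∈ latticeN κ ∧ w ≠ 0) ∧
      ((Fan.ofCone σ hfg hsal).starIter l).Refines (Fan.ofCone σ hfg hsal) ∧
      ((Fan.ofCone σ hfg hsal).starIter l).IsRegular ∧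
      ((Fan.ofCone σ hfg hsal).starIter l).IsSimplicial ∧
      ∃ m : PointedCone ℚ (κ → ℚ) → (κ → ℚ),
        ((Fan.ofCone σ hfg hsal).starIter l).IsStrictSupport m ∧
        (∀ ρ ∈ ((Fan.ofCone σ hfg hsal).starIter l).cones, m ρ ∈ latticeN κ) ∧
        (∀ ρ ∈ ((Fan.ofCone σ hfg hsal).starIter l).cones, ∀ x ∈ σ, 0 ≤ m ρ ⬝ᵥ x) := by
  obtain ⟨l, hl, href, hreg, hsimp⟩ :=
    Fan.exists_regular_refinement _ (Fan.isRational_ofCone hfg hsal)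
  exact ⟨l, hl, href, hreg, hsimp, Fan.exists_isStrictSupport_starIter σ hfg hsal l⟩

end Rational

end Literature.Geometry.PolyhedralFans

end
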